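import Mathlib
import HarnessLib
import Summits.NavierStokesRegularity.NavierStokesRegularity.Theorems.PoloidalWindowDoorLrcModEntireTwistingTHLocalHypGerm
import Summits.NavierStokesRegularity.NavierStokesRegularity.Theorems.PoloidalWindowDoorPoloidalWindowRigiditySparseEnergySourceFreeDatum

/-!
# Route `PoloidalWindowDoor`, item `LrcModEntire` (stmt-NavierStokesRegularity-20428) — the (TH)∩twisting column ON K-SPARSE PROFILES,
# in the item's GERM currency, from the SOURCE-FREE local statement `hemptyHypSF`

Seat ns-poloidal-K2-p3 g9 (LEAD of item 20428; file `--supports`).  The 20428-side twin of K2-p2 g9's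
`…TwistingTHSparse.stub_hyperbolicTHSparse_of_localEmptyHypSF` (p619942, crux 19708 currency): item 20428's `stub_twistingTH`
(twist_split v4.x: class + non-degenerate pinned twisting (TH) window ⇒ the germ trichotomy, vacuously) WITH the K-sparse energy bound of
line `sparse_energy` (stub S1 `stub_scaledEnergy`) inserted after poloidality, follows from the SOURCE-FREE local statement
`hemptyHypSF` := twist_split v4.1's `stub_localTHEmptyHyp` with ONE MORE hypothesis `∀ p ∈ U, A p.1 (p.2 2) = 0` before `False`
(binder-identical to K2-p2 g9's `hemptyHypSF`).  Proof = `…TwistingTHLocalHypGerm.stub_twistingTH_of_localEmptyHyp` with K2-p3 g7's datum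
`exists_localTHDatum` replaced by K2-p2 g8's `…SparseEnergySourceFreeDatum.exists_localTHDatum_sourceFree` (p615536): relocate to a
hyperbolic window (`exists_hyperbolicTHWindow`), take the source-free datum there, read the sign of the slope at the base point
(`slope_neg_of_typeScalar_neg`), apply `hemptyHypSF`.

This is the reduction a v4.4 skeleton `{stub_scaledEnergy, <source-free local stub>, stub_twistingThick}` needs on the item side: with S1
the K-bound is discharged per profile, and every normal-form refinement of `hemptyHypSF` (non-umbilic point, rest frame with the explicit
datum `c₂(∂ₜμ − ∂_z²μ) − (c₂²/2)∂_zμ`, rotation/scaling gauge — crux workfile `Lines/twist_split_v44_DRAFT.lean`) plugs in above it.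

WHAT THIS IS NOT: not a proof of the stub, not a claim about Navier–Stokes regularity — a by-name reduction, conditional in use on S1
(bears_on LADDER-NS N0 via crux 19708 / item 20428).
-/

noncomputable section

-- the summit and its single sub-problem share the name (CONVENTIONS §1), as in every Theorems file
set_option linter.dupNamespace false

namespace Summit.NavierStokesRegularity.NavierStokesRegularity.Theorems.PoloidalWindowDoorLrcModEntireTwistingTHSparseGerm

open Set Function Filter Topology Metric
open scoped RealInnerProductSpace InnerProductSpace Laplacian ENNReal
open Literature.Analysis Literature.Analysis.FluidPDE
open Summit.NavierStokesRegularity.NavierStokesRegularity.Theorems.PoloidalWindowDoorLrcModEntireTwistingTHLocalHypGerm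
open Summit.NavierStokesRegularity.NavierStokesRegularity.Theorems.PoloidalWindowDoorPoloidalWindowRigiditySparseEnergySourceFreeDatum

/-- **`stub_twistingTH` ON K-SPARSE PROFILES ⇐ `hemptyHypSF`** (item 20428's germ currency): class + poloidal + bounded scale-invariant
energy `∫_{B_R(a)}|v(t₀)|² ≤ K·R` + a nonempty open non-degenerate, pinned, twisting, (TH) window ⇒ the germ trichotomy — vacuously, since
the source-free local hyperbolic (TH)∩twisting system is empty by `hemptyHypSF`. [folklore] -/
theorem stub_twistingTHSparse_of_localEmptyHypSF
    (hemptyHypSF : ∀ (u : ℝ → EuclideanSpace ℝ (Fin 3) → EuclideanSpace ℝ (Fin 3)) (μ A : ℝ → ℝ → ℝ)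
      (U : Set (ℝ × EuclideanSpace ℝ (Fin 3))) (p₀ : ℝ × EuclideanSpace ℝ (Fin 3)),
      IsOpen U → p₀ ∈ U →
      AnalyticOnNhd ℝ (Function.uncurry u) U →
      (∀ p ∈ U, AnalyticAt ℝ (Function.uncurry μ) (p.1, p.2 2)) →
      (∀ p ∈ U, AnalyticAt ℝ (Function.uncurry A) (p.1, p.2 2)) →
      (∀ p ∈ U, fderiv ℝ (u p.1) p.2 (EuclideanSpace.single 0 1) 1 = fderiv ℝ (u p.1) p.2 (EuclideanSpace.single 1 1) 0) →
      (∀ p ∈ U, fderiv ℝ (u p.1) p.2 (EuclideanSpace.single 0 1) 0 + fderiv ℝ (u p.1) p.2 (EuclideanSpace.single 1 1) 1 +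
        fderiv ℝ (u p.1) p.2 (EuclideanSpace.single 2 1) 2 = 0) →
      (∀ p ∈ U, ∀ b : Fin 3, b ≠ 2 →
        fderiv ℝ (u p.1) p.2 (EuclideanSpace.single 2 1) b =
          μ p.1 (p.2 2) * fderiv ℝ (u p.1) p.2 (EuclideanSpace.single b 1) 2) →
      (∀ p ∈ U,
        (1 - μ p.1 (p.2 2)) *
            (deriv (fun s => u s p.2 2) p.1 + fderiv ℝ (fun y => u p.1 y 2) p.2 (u p.1 p.2)
              - Δ (fun y => u p.1 y 2) p.2) =
          A p.1 (p.2 2) + (deriv (fun s => μ s (p.2 2)) p.1 - deriv (deriv (μ p.1)) (p.2 2)) * u p.1 p.2 2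
            + deriv (μ p.1) (p.2 2) / 2 * u p.1 p.2 2 ^ 2
            - 2 * deriv (μ p.1) (p.2 2) * fderiv ℝ (u p.1) p.2 (EuclideanSpace.single 2 1) 2) →
      fderiv ℝ (fun y => fderiv ℝ (u p₀.1) y (EuclideanSpace.single 2 1) 2) p₀.2 (EuclideanSpace.single 0 1) *
            fderiv ℝ (u p₀.1) p₀.2 (EuclideanSpace.single 1 1) 2 -
          fderiv ℝ (fun y => fderiv ℝ (u p₀.1) y (EuclideanSpace.single 2 1) 2) p₀.2 (EuclideanSpace.single 1 1) *
            fderiv ℝ (u p₀.1) p₀.2 (EuclideanSpace.single 0 1) 2 ≠ 0 →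
      μ p₀.1 (p₀.2 2) ≠ 0 → μ p₀.1 (p₀.2 2) ≠ 1 → deriv (μ p₀.1) (p₀.2 2) ≠ 0 →
      μ p₀.1 (p₀.2 2) < 0 → 
      (∀ p ∈ U, A p.1 (p.2 2) = 0) → False) :
    ∀ (C : ℝ) (v : ℝ → EuclideanSpace ℝ (Fin 3) → EuclideanSpace ℝ (Fin 3)),
      Literature.Analysis.FluidPDE.HasTypeITimeDecay C v →
      ContinuousOn (Function.uncurry v) (Set.Iio (0 : ℝ) ×ˢ Set.univ) →
      (∀ s t : ℝ, s < t → t < 0 → ∀ x, v t x =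
        Literature.Analysis.UnboundedOperators.heatExtension (v s) (t - s) x -
          Literature.Analysis.FluidPDE.oseenDuhamel 1 s v v t x) →
      (∀ t < 0, Literature.Analysis.FluidPDE.VectorCalculus.IsDivFree (v t)) →
      (∀ s < 0, ∀ y, ⟪Literature.Analysis.FluidPDE.curl (v s) y, EuclideanSpace.single 2 1⟫_ℝ = 0) →
      ∀ K : ℝ, 0 ≤ K →
        (∀ t₀ : ℝ, t₀ < 0 → ∀ (a : EuclideanSpace ℝ (Fin 3)) (R : ℝ), 0 < R →
          (∫⁻ x in Metric.ball a R, ENNReal.ofReal (‖v t₀ x‖ ^ 2)) ≤ ENNReal.ofReal (K * R)) →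
      ∀ W : Set (ℝ × EuclideanSpace ℝ (Fin 3)), IsOpen W → W.Nonempty → W ⊆ Set.Iio (0 : ℝ) ×ˢ Set.univ →
        (∀ z ∈ W, Literature.Analysis.FluidPDE.curl (v z.1) z.2 ≠ 0 ∧
          (fderiv ℝ (v z.1) z.2 (EuclideanSpace.single 0 1) 2 ≠ 0 ∨ fderiv ℝ (v z.1) z.2 (EuclideanSpace.single 1 1) 2 ≠ 0) ∧
          (fderiv ℝ (v z.1) z.2 (EuclideanSpace.single 2 1) 0 ≠ 0 ∨ fderiv ℝ (v z.1) z.2 (EuclideanSpace.single 2 1) 1 ≠ 0)) →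
        (∀ m : ℝ → ℝ, ∀ W₁ : Set (ℝ × EuclideanSpace ℝ (Fin 3)), W₁ ⊆ W → IsOpen W₁ → W₁.Nonempty →
          ∃ z ∈ W₁, ∃ b : Fin 3, b ≠ 2 ∧
            fderiv ℝ (v z.1) z.2 (EuclideanSpace.single 2 1) b ≠
              m z.1 * fderiv ℝ (v z.1) z.2 (EuclideanSpace.single b 1) 2) →
        (∀ z ∈ W,
          fderiv ℝ (fun x => fderiv ℝ (v z.1) x (EuclideanSpace.single 2 1) 2) z.2 (EuclideanSpace.single 0 1) *
              fderiv ℝ (v z.1) z.2 (EuclideanSpace.single 1 1) 2 -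
            fderiv ℝ (fun x => fderiv ℝ (v z.1) x (EuclideanSpace.single 2 1) 2) z.2 (EuclideanSpace.single 1 1) *
              fderiv ℝ (v z.1) z.2 (EuclideanSpace.single 0 1) 2 ≠ 0) →
        (∃ m : ℝ → ℝ → ℝ, ∀ z ∈ W, ∀ b : Fin 3, b ≠ 2 →
          fderiv ℝ (v z.1) z.2 (EuclideanSpace.single 2 1) b =
            m z.1 (z.2 2) * fderiv ℝ (v z.1) z.2 (EuclideanSpace.single b 1) 2) →
        ∃ s : ℝ, s < 0 ∧ ∃ U : Set (EuclideanSpace ℝ (Fin 3)), IsOpen U ∧ U.Nonempty ∧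
          ((∃ e : EuclideanSpace ℝ (Fin 3), e ≠ 0 ∧
              ∀ y ∈ U, fderiv ℝ (Literature.Analysis.FluidPDE.curl (v s)) y e = 0) ∨
           (∃ c : EuclideanSpace ℝ (Fin 3), ∀ y ∈ U,
              Literature.Analysis.FluidPDE.rotGen (Literature.Analysis.FluidPDE.curl (v s) y) =
                fderiv ℝ (Literature.Analysis.FluidPDE.curl (v s)) y (Literature.Analysis.FluidPDE.rotGen (y - c))) ∨
           (∃ w : EuclideanSpace ℝ (Fin 3) → EuclideanSpace ℝ (Fin 3), AnalyticOnNhd ℝ w Set.univ ∧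
              ¬ BddAbove (Set.range fun y => ‖w y‖) ∧ ∀ y ∈ U, v s y = w y)) := by
  intro C v hrate hcont hmild hdiv hpol K hK0 hK W hW hWne hWs hnd hpin htw hTH
  exfalso
  obtain ⟨W', hW'o, hW'ne, hW's, hW'nd, hW'pin, hW'T, hW'I, m', hm'⟩ :=
    exists_hyperbolicTHWindow C v hrate hcont hmild hdiv W hW hWne hWs hnd hpin htw hTH
  obtain ⟨μ, A, U, p₀, hUo, hp₀U, hUW, han, hμan, hAan, hpolU, hdivU, hsh, hE, htw0, hm0, hm1, hmz, hA0⟩ :=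
    exists_localTHDatum_sourceFree hrate hcont hmild hdiv hpol hK0 hK hW'o hW'ne hW's hW'nd hW'pin hW'T hm'
  have hneg : μ p₀.1 (p₀.2 2) < 0 :=
    slope_neg_of_typeScalar_neg (hsh p₀ hp₀U 0 (by decide)) (hsh p₀ hp₀U 1 (by decide)) (hW'I p₀ (hUW hp₀U))
  exact hemptyHypSF v μ A U p₀ hUo hp₀U han hμan hAan hpolU hdivU hsh hE htw0 hm0 hm1 hmz hneg hA0

end Summit.NavierStokesRegularity.NavierStokesRegularity.Theorems.PoloidalWindowDoorLrcModEntireTwistingTHSparseGerm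

end
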